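import Summits.ResolutionOfSingularities.ResolutionOfSingularities.Theorems.WildConesClassicalRegimesStubMuDropCharTwoOrdPGeneric

/-!
# Milnor drop in characteristic two (`stub_muDropCharTwoOrdP`) — helper 2/8: BlowFam

Helper file for the stub `stub_muDropCharTwoOrdP` of crux `ClassicalRegimes`
(stmt-ResolutionOfSingularities-16884, route `WildCones`, line `milnor-descent`): the one-step drop
of the Milnor number `μ = dim_κ κ⟦u₁,…,uₙ⟧/(∂a)` of the cleaned state of `z² = a(u)` under the
point-blow-up dynamics in characteristic two, `n ≥ 3`. The proof works on formal power series:
a hyperbolic pair `u_j u_l` of the quadratic part of `a` is split off by the formal coordinate change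
`u_j ↦ q⁻¹ ∂_l a, u_l ↦ q⁻¹ ∂_j a` (formal inverse function theorem; `∂_j ∂_j = 0` in
characteristic two makes `∂_j ã ∈ (u_l)`, `∂_l ã ∈ (u_j)`), which commutes with the strict
transform; killing `u_j, u_l` descends to `n - 2` variables with the same Milnor algebras. The
leaves: `n ≥ 3` residual variables without hyperbolic pair are not isolated (Case A), `n = 1` is
`μ = ord - 1`, and `n = 2` is Max Noether's inequality `I(∂ₓa, ∂_y a) ≥ m m' + I(strict transforms)`
at the point of the exceptional line plus the multiplicity `≤ 3` of that line in `(∂G)`.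
Sources: G.-M. Greuel, G. Pfister, *The splitting lemma in any characteristic*, J. Algebra 689
(2026) = arXiv:2507.17078, Thm. 3.5 / Cor. 3.7 (the hyperbolic pair; only its linear part is used);
E. Casas-Alvero, *Singularities of Plane Curves*, §3 (Noether's formula); folklore otherwise.

This file: the blow-up substitution `Φ_{i,τ} : X_i ↦ X_i, X_s ↦ X_i (X_s + τ_s)`: chain rule, the gradient of a strict transform `X_i² G = a∘Φ` (`X_i ∂ₘG = (∂ₘa)∘Φ`), divisibility by powers of `X_i`, the linear and `X_i X_j` coefficients after the blow-up, and the existence of a hyperbolic pair avoiding the chart index.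
-/

noncomputable section

-- single-problem summit: the doubled namespace component `ResolutionOfSingularities` is forced
set_option linter.dupNamespace false

open scoped BigOperators Classical

open MvPowerSeries IsLocalRing

open Literature.AlgebraicGeometry.Resolution

namespace Summit.ResolutionOfSingularities.ResolutionOfSingularities.Theorems.WildCones

namespace MuDropCharTwoOrdP

variable {κ : Type} [Field κ]

/-! ## The blow-up substitution `Φ_{i,τ} : X_i ↦ X_i, X_s ↦ X_i (X_s + τ_s)` -/

section BlowFam

variable {n : ℕ} (i : Fin n) (τ : Fin n → κ)

/-- The blow-up family has zero constant terms. [folklore] -/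
theorem constantCoeff_blowFam (s : Fin n) :
    constantCoeff ((fun s => if s = i then (X i : MvPowerSeries (Fin n) κ)
      else X i * (X s + C (τ s))) s) = 0 := by
  by_cases hs : s = i
  · simp [hs, constantCoeff_X]
  · simp [hs, constantCoeff_X]

/-- The blow-up family is substitutable. [folklore] -/
theorem hasSubst_blowFam :
    HasSubst (fun s => if s = i then (X i : MvPowerSeries (Fin n) κ) else X i * (X s + C (τ s))) :=
  hasSubst_of_constantCoeff_zero (constantCoeff_blowFam i τ)

/-- Partial derivatives kill constants. [folklore] -/
theorem pderiv_C (m : Fin n) (c : κ) : MvPowerSeries.pderiv m (C c : MvPowerSeries (Fin n) κ) = 0 := by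
  rw [MvPowerSeries.c_eq_algebraMap]
  exact Derivation.map_algebraMap _ c

/-- Partial derivatives of the blow-up family in a direction `m ≠ i`. [folklore] -/
theorem pderiv_blowFam_of_ne {m : Fin n} (hm : m ≠ i) (s : Fin n) :
    MvPowerSeries.pderiv m ((fun s => if s = i then (X i : MvPowerSeries (Fin n) κ)
      else X i * (X s + C (τ s))) s) = if s = m then X i else 0 := by
  have him : ¬ i = m := fun h => hm h.symm
  by_cases hs : s = i
  · subst hs
    simp only [if_true, MvPowerSeries.pderiv_X, if_neg him]
  · simp only [if_neg hs]
    rw [Derivation.leibniz, map_add, pderiv_C, add_zero, MvPowerSeries.pderiv_X,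
      MvPowerSeries.pderiv_X, if_neg him, smul_zero, add_zero, smul_eq_mul]
    by_cases hsm : s = m
    · simp [hsm]
    · simp [hsm]

/-- Partial derivatives of the blow-up family in the direction `i`. [folklore] -/
theorem pderiv_blowFam_self (s : Fin n) :
    MvPowerSeries.pderiv i ((fun s => if s = i then (X i : MvPowerSeries (Fin n) κ)
      else X i * (X s + C (τ s))) s) = if s = i then 1 else X s + C (τ s) := by
  by_cases hs : s = i
  · subst hs
    simp [MvPowerSeries.pderiv_X]
  · simp only [if_neg hs]
    rw [Derivation.leibniz, map_add, pderiv_C, add_zero, MvPowerSeries.pderiv_X,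
      MvPowerSeries.pderiv_X, if_neg hs, if_pos rfl, smul_zero, zero_add, smul_eq_mul, mul_one]

/-- CHAIN RULE along the blow-up, direction `m ≠ i`: `∂ₘ (f∘Φ) = X_i · (∂ₘ f)∘Φ`. [folklore] -/
theorem pderiv_subst_blowFam_of_ne {m : Fin n} (hm : m ≠ i) (f : MvPowerSeries (Fin n) κ) :
    MvPowerSeries.pderiv m (subst (fun s => if s = i then (X i : MvPowerSeries (Fin n) κ)
      else X i * (X s + C (τ s))) f) =
      X i * subst (fun s => if s = i then (X i : MvPowerSeries (Fin n) κ)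
        else X i * (X s + C (τ s))) (MvPowerSeries.pderiv m f) := by
  rw [MvPowerSeries.pderiv_subst (constantCoeff_blowFam i τ)]
  rw [Finset.sum_eq_single m]
  · rw [pderiv_blowFam_of_ne i τ hm, if_pos rfl, mul_comm]
  · intro s _ hs
    rw [pderiv_blowFam_of_ne i τ hm, if_neg hs, mul_zero]
  · intro h; exact absurd (Finset.mem_univ m) h

/-- CHAIN RULE along the blow-up, direction `i`:
`∂ᵢ (f∘Φ) = (∂ᵢ f)∘Φ + ∑_{s ≠ i} (X_s + τ_s) · (∂ₛ f)∘Φ`. [folklore] -/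
theorem pderiv_subst_blowFam_self (f : MvPowerSeries (Fin n) κ) :
    MvPowerSeries.pderiv i (subst (fun s => if s = i then (X i : MvPowerSeries (Fin n) κ)
      else X i * (X s + C (τ s))) f) =
      subst (fun s => if s = i then (X i : MvPowerSeries (Fin n) κ)
        else X i * (X s + C (τ s))) (MvPowerSeries.pderiv i f) +
      ∑ s ∈ Finset.univ.erase i, (X s + C (τ s)) *
        subst (fun s => if s = i then (X i : MvPowerSeries (Fin n) κ)
          else X i * (X s + C (τ s))) (MvPowerSeries.pderiv s f) := by
  rw [MvPowerSeries.pderiv_subst (constantCoeff_blowFam i τ), ← Finset.add_sum_erase _ _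
    (Finset.mem_univ i)]
  congr 1
  · rw [pderiv_blowFam_self i τ, if_pos rfl, mul_one]
  · refine Finset.sum_congr rfl fun s hs => ?_
    rw [pderiv_blowFam_self i τ, if_neg (Finset.ne_of_mem_erase hs), mul_comm]

/-- THE GRADIENT OF THE STRICT TRANSFORM (characteristic two): if `X_i² G = a∘Φ` then
`X_i ∂ₘ G = (∂ₘ a)∘Φ` for `m ≠ i`. [folklore] -/
theorem X_mul_pderiv_strict_of_ne [CharP κ 2] {m : Fin n} (hm : m ≠ i)
    {a G : MvPowerSeries (Fin n) κ}
    (hG : X i ^ 2 * G = subst (fun s => if s = i then (X i : MvPowerSeries (Fin n) κ)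
      else X i * (X s + C (τ s))) a) :
    X i * MvPowerSeries.pderiv m G = subst (fun s => if s = i then (X i : MvPowerSeries (Fin n) κ)
      else X i * (X s + C (τ s))) (MvPowerSeries.pderiv m a) := by
  have h := congrArg (MvPowerSeries.pderiv m) hG
  rw [pderiv_X_sq_mul, pderiv_subst_blowFam_of_ne i τ hm, pow_two, mul_assoc] at h
  exact MvPowerSeries.X_mul_cancel h

/-- THE GRADIENT OF THE STRICT TRANSFORM (characteristic two), direction `i`:
`X_i² ∂ᵢ G = (∂ᵢ a)∘Φ + ∑_{s ≠ i} (X_s + τ_s) X_i ∂ₛ G`. [folklore] -/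
theorem X_sq_mul_pderiv_strict_self [CharP κ 2] {a G : MvPowerSeries (Fin n) κ}
    (hG : X i ^ 2 * G = subst (fun s => if s = i then (X i : MvPowerSeries (Fin n) κ)
      else X i * (X s + C (τ s))) a) :
    X i ^ 2 * MvPowerSeries.pderiv i G =
      subst (fun s => if s = i then (X i : MvPowerSeries (Fin n) κ)
        else X i * (X s + C (τ s))) (MvPowerSeries.pderiv i a) +
      ∑ s ∈ Finset.univ.erase i, (X s + C (τ s)) * (X i * MvPowerSeries.pderiv s G) := by
  have h := congrArg (MvPowerSeries.pderiv i) hG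
  rw [pderiv_X_sq_mul, pderiv_subst_blowFam_self i τ] at h
  rw [h]
  congr 1
  refine Finset.sum_congr rfl fun s hs => ?_
  rw [X_mul_pderiv_strict_of_ne i τ (Finset.ne_of_mem_erase hs) hG]

/-- `X_i` divides every member of the blow-up family. [folklore] -/
theorem X_dvd_blowFam (s : Fin n) :
    (X i : MvPowerSeries (Fin n) κ) ∣ (fun s => if s = i then (X i : MvPowerSeries (Fin n) κ)
      else X i * (X s + C (τ s))) s := by
  by_cases hs : s = i
  · simp [hs]
  · simp only [if_neg hs]; exact dvd_mul_right _ _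

/-- DIVISIBILITY: `X_i ^ d ∣ f∘Φ` whenever `d ≤ ord f`. [folklore] -/
theorem X_pow_dvd_subst_blowFam {f : MvPowerSeries (Fin n) κ} {d : ℕ} (hd : (d : ℕ∞) ≤ f.order) :
    (X i : MvPowerSeries (Fin n) κ) ^ d ∣ subst (fun s => if s = i then (X i : MvPowerSeries (Fin n) κ)
      else X i * (X s + C (τ s))) f := by
  -- adapted from `Literature.AlgebraicGeometry.Resolution.PlaneGerm.X_pow_dvd_subst`
  rw [X_pow_dvd_iff]
  intro e he
  rw [coeff_subst (hasSubst_blowFam i τ)]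
  apply finsum_eq_zero_of_forall_eq_zero
  intro d'
  by_cases hd' : d'.degree < d
  · rw [coeff_of_lt_order (lt_of_lt_of_le (by exact_mod_cast hd') hd), zero_smul]
  · have hdvd : (X i : MvPowerSeries (Fin n) κ) ^ d ∣ d'.prod fun s m =>
        ((fun s => if s = i then (X i : MvPowerSeries (Fin n) κ) else X i * (X s + C (τ s))) s) ^ m := by
      have h2 : (X i : MvPowerSeries (Fin n) κ) ^ d'.degree ∣ d'.prod fun s m =>
          ((fun s => if s = i then (X i : MvPowerSeries (Fin n) κ) else X i * (X s + C (τ s))) s) ^ m := by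
        rw [Finsupp.prod, Finsupp.degree_apply, ← Finset.prod_pow_eq_pow_sum]
        exact Finset.prod_dvd_prod_of_dvd _ _ fun s _ => pow_dvd_pow_of_dvd (X_dvd_blowFam i τ s) _
      exact (pow_dvd_pow _ (not_lt.mp hd')).trans h2
    rw [X_pow_dvd_iff.mp hdvd e he, smul_zero]

/-- The image of a series of order `≥ 2` under the blow-up has no `X_i` and no `X_i X_j`
coefficients. [folklore] -/
theorem coeff_subst_blowFam_eq_zero_of_two_le {f : MvPowerSeries (Fin n) κ} (hf : 2 ≤ f.order)
    (e : Fin n →₀ ℕ) (he : e i < 2) :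
    coeff e (subst (fun s => if s = i then (X i : MvPowerSeries (Fin n) κ)
      else X i * (X s + C (τ s))) f) = 0 :=
  X_pow_dvd_iff.mp (X_pow_dvd_subst_blowFam i τ (d := 2) (by exact_mod_cast hf)) e he

/-- Splitting off the linear part of a series without constant term. [folklore] -/
theorem two_le_order_sub_linear {f : MvPowerSeries (Fin n) κ} (hf : constantCoeff f = 0) :
    2 ≤ (f - ∑ s, coeff (Finsupp.single s 1) f • (X s : MvPowerSeries (Fin n) κ)).order := by
  rw [FormalCoordChange.two_le_order_iff]
  refine ⟨?_, fun t => ?_⟩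
  · simp [hf, map_sum, constantCoeff_X]
  · simp only [map_sub, map_sum, coeff_smul, coeff_index_single_X, mul_ite, mul_one, mul_zero,
      Finset.sum_ite_eq, Finset.mem_univ, if_true, sub_self]

/-- A product of two variables has no linear coefficients. [folklore] -/
theorem coeff_single_X_mul_X (s t u : Fin n) :
    coeff (Finsupp.single u 1) (X s * X t : MvPowerSeries (Fin n) κ) = 0 := by
  rw [X_def, X_def, monomial_mul_monomial, coeff_monomial, if_neg]
  intro h
  have := congrArg Finsupp.degree h
  simp only [map_add, Finsupp.degree_single] at this
  omega

/-- THE `X_i`-COEFFICIENT after the blow-up: `[X_i](f∘Φ) = [X_i] f + ∑_{s ≠ i} τ_s [X_s] f` for `f`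
without constant term. [folklore] -/
theorem coeff_single_subst_blowFam {f : MvPowerSeries (Fin n) κ} (hf : constantCoeff f = 0) :
    coeff (Finsupp.single i 1) (subst (fun s => if s = i then (X i : MvPowerSeries (Fin n) κ)
      else X i * (X s + C (τ s))) f) =
      coeff (Finsupp.single i 1) f + ∑ s ∈ Finset.univ.erase i, τ s * coeff (Finsupp.single s 1) f := by
  have hΦ := hasSubst_blowFam i τ
  set L := ∑ s, coeff (Finsupp.single s 1) f • (X s : MvPowerSeries (Fin n) κ) with hL
  have key : subst (fun s => if s = i then (X i : MvPowerSeries (Fin n) κ)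
      else X i * (X s + C (τ s))) f = subst (fun s => if s = i then (X i : MvPowerSeries (Fin n) κ)
      else X i * (X s + C (τ s))) L + subst (fun s => if s = i then (X i : MvPowerSeries (Fin n) κ)
      else X i * (X s + C (τ s))) (f - L) := by
    rw [← subst_add hΦ, add_sub_cancel]
  rw [key, map_add, coeff_subst_blowFam_eq_zero_of_two_le i τ
    (two_le_order_sub_linear hf) _ (by simp), add_zero, hL, ← coe_substAlgHom hΦ, map_sum]
  simp only [map_smul, coe_substAlgHom, subst_X hΦ, map_sum, smul_eq_mul]
  rw [← Finset.add_sum_erase _ _ (Finset.mem_univ i)]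
  congr 1
  · simp
  · refine Finset.sum_congr rfl fun s hs => ?_
    have hsi : s ≠ i := Finset.ne_of_mem_erase hs
    rw [if_neg hsi, mul_add, map_add, ← (commute_X (C (τ s)) i).eq, coeff_C_mul,
      coeff_index_single_self_X, mul_one, coeff_single_X_mul_X, zero_add, mul_comm]

/-- A product of two variables `X_i X_s` has coefficient `δ_{s j}` at `X_i X_j`. [folklore] -/
theorem coeff_pair_X_mul_X (s j : Fin n) :
    coeff (Finsupp.single i 1 + Finsupp.single j 1) (X i * X s : MvPowerSeries (Fin n) κ) =
      if s = j then 1 else 0 := by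
  rw [X_def, X_def, monomial_mul_monomial, coeff_monomial, one_mul]
  by_cases hsj : s = j
  · subst hsj; simp
  · rw [if_neg, if_neg hsj]
    intro h
    exact hsj ((Finsupp.single_left_inj one_ne_zero).mp (add_left_cancel h)).symm

/-- Multiplication by `X_i` shifts coefficients. [folklore] -/
theorem coeff_single_add_X_mul (e : Fin n →₀ ℕ) (g : MvPowerSeries (Fin n) κ) :
    coeff (Finsupp.single i 1 + e) (X i * g) = coeff e g := by
  rw [X_def, coeff_monomial_mul, if_pos (by simp), one_mul, add_tsub_cancel_left]

/-- THE `X_i X_j`-COEFFICIENT after the blow-up: `[X_i X_j](f∘Φ) = [X_j] f` (`j ≠ i`) for `f`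
without constant term. [folklore] -/
theorem coeff_pair_subst_blowFam {f : MvPowerSeries (Fin n) κ} (hf : constantCoeff f = 0)
    {j : Fin n} (hj : j ≠ i) :
    coeff (Finsupp.single i 1 + Finsupp.single j 1) (subst (fun s => if s = i then
      (X i : MvPowerSeries (Fin n) κ) else X i * (X s + C (τ s))) f) = coeff (Finsupp.single j 1) f := by
  have hΦ := hasSubst_blowFam i τ
  set L := ∑ s, coeff (Finsupp.single s 1) f • (X s : MvPowerSeries (Fin n) κ) with hL
  have key : subst (fun s => if s = i then (X i : MvPowerSeries (Fin n) κ)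
      else X i * (X s + C (τ s))) f = subst (fun s => if s = i then (X i : MvPowerSeries (Fin n) κ)
      else X i * (X s + C (τ s))) L + subst (fun s => if s = i then (X i : MvPowerSeries (Fin n) κ)
      else X i * (X s + C (τ s))) (f - L) := by
    rw [← subst_add hΦ, add_sub_cancel]
  have hei : (Finsupp.single i 1 + Finsupp.single j 1 : Fin n →₀ ℕ) i < 2 := by
    simp [Ne.symm hj]
  rw [key, map_add, coeff_subst_blowFam_eq_zero_of_two_le i τ
    (two_le_order_sub_linear hf) _ hei, add_zero, hL, ← coe_substAlgHom hΦ, map_sum]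
  simp only [map_smul, coe_substAlgHom, subst_X hΦ, map_sum, smul_eq_mul]
  rw [Finset.sum_eq_single j]
  · rw [if_neg hj, mul_add, map_add, ← (commute_X (C (τ j)) i).eq, coeff_C_mul,
      coeff_pair_X_mul_X, if_pos rfl, coeff_X, if_neg, mul_zero, add_zero, mul_one]
    intro h
    have := congrArg Finsupp.degree h
    simp only [map_add, Finsupp.degree_single] at this
    omega
  · intro s _ hsj
    by_cases hsi : s = i
    · subst hsi
      rw [if_pos rfl, coeff_X, if_neg, mul_zero]
      intro h
      have := congrArg Finsupp.degree h
      simp only [map_add, Finsupp.degree_single] at this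
      omega
    · rw [if_neg hsi, mul_add, map_add, ← (commute_X (C (τ s)) i).eq, coeff_C_mul,
        coeff_pair_X_mul_X, if_neg hsj, coeff_X, if_neg, mul_zero, add_zero, mul_zero]
      intro h
      have := congrArg Finsupp.degree h
      simp only [map_add, Finsupp.degree_single] at this
      omega
  · intro h; exact absurd (Finset.mem_univ j) h

/-- LINEAR COEFFICIENTS OF THE STRICT TRANSFORM: if `X_i² G = a∘Φ` with `ord a ≥ 2` then for
`m ≠ i`, `[X_m] G = [X_i X_m] a + ∑_{s ≠ i} τ_s (δ_{sm} + 1) [X_s X_m] a`. [folklore] -/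
theorem coeff_single_strict [CharP κ 2] {a G : MvPowerSeries (Fin n) κ} (ha : 2 ≤ a.order)
    (hG : X i ^ 2 * G = subst (fun s => if s = i then (X i : MvPowerSeries (Fin n) κ)
      else X i * (X s + C (τ s))) a) {m : Fin n} (hm : m ≠ i) :
    coeff (Finsupp.single m 1) G = coeff (Finsupp.single i 1 + Finsupp.single m 1) a +
      ∑ s ∈ Finset.univ.erase i, τ s * ((((Finsupp.single s 1 : Fin n →₀ ℕ) m : ℕ) : κ) + 1) *
        coeff (Finsupp.single s 1 + Finsupp.single m 1) a := by
  have ha' := (FormalCoordChange.two_le_order_iff a).mp ha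
  have h := X_mul_pderiv_strict_of_ne i τ hm hG
  have h0 : constantCoeff (MvPowerSeries.pderiv m a) = 0 := by
    rw [constantCoeff_pderiv]; exact ha'.2 m
  have h1 := congrArg (coeff (Finsupp.single i 1)) h
  rw [coeff_single_subst_blowFam i τ h0, ← add_zero (Finsupp.single i 1 : Fin n →₀ ℕ),
    coeff_single_add_X_mul, add_zero, coeff_zero_eq_constantCoeff_apply, constantCoeff_pderiv,
    coeff_single_pderiv] at h1
  rw [h1]
  congr 1
  · simp [Ne.symm hm]
  · refine Finset.sum_congr rfl fun s _ => ?_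
    rw [coeff_single_pderiv, mul_assoc]

/-- PAIR COEFFICIENTS OF THE STRICT TRANSFORM: if `X_i² G = a∘Φ` with `ord a ≥ 2` then for
`j ≠ l`, both `≠ i`, `[X_j X_l] G = [X_j X_l] a`. [folklore] -/
theorem coeff_pair_strict [CharP κ 2] {a G : MvPowerSeries (Fin n) κ} (ha : 2 ≤ a.order)
    (hG : X i ^ 2 * G = subst (fun s => if s = i then (X i : MvPowerSeries (Fin n) κ)
      else X i * (X s + C (τ s))) a) {j l : Fin n} (hjl : j ≠ l) (hj : j ≠ i) (hl : l ≠ i) :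
    coeff (Finsupp.single j 1 + Finsupp.single l 1) G =
      coeff (Finsupp.single j 1 + Finsupp.single l 1) a := by
  have ha' := (FormalCoordChange.two_le_order_iff a).mp ha
  have h := X_mul_pderiv_strict_of_ne i τ hl hG
  have h0 : constantCoeff (MvPowerSeries.pderiv l a) = 0 := by
    rw [constantCoeff_pderiv]; exact ha'.2 l
  have h1 := congrArg (coeff (Finsupp.single i 1 + Finsupp.single j 1)) h
  rw [coeff_pair_subst_blowFam i τ h0 hj, coeff_single_add_X_mul, coeff_single_pderiv,
    coeff_single_pderiv] at h1
  have hjl' : (((Finsupp.single j 1 : Fin n →₀ ℕ) l : ℕ) : κ) + 1 = 1 := by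
    simp [hjl]
  rwa [hjl', one_mul, one_mul] at h1

/-- A PAIR AWAY FROM THE CHART INDEX: if `a` (of order `≥ 2`) has some non-zero coefficient at a
square-free quadratic monomial and the strict transform `G` has no linear terms, then `a` has
such a coefficient at a monomial `X_j X_l` with `j, l ≠ i`. [folklore] -/
theorem exists_pair_ne [CharP κ 2] {a G : MvPowerSeries (Fin n) κ} (ha : 2 ≤ a.order)
    (hG : X i ^ 2 * G = subst (fun s => if s = i then (X i : MvPowerSeries (Fin n) κ)
      else X i * (X s + C (τ s))) a)
    (hlin : ∀ m, coeff (Finsupp.single m 1) G = 0)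
    (hpair : ∃ j l : Fin n, j ≠ l ∧ coeff (Finsupp.single j 1 + Finsupp.single l 1) a ≠ 0) :
    ∃ j l : Fin n, j ≠ l ∧ j ≠ i ∧ l ≠ i ∧
      coeff (Finsupp.single j 1 + Finsupp.single l 1) a ≠ 0 := by
  by_contra H
  push Not at H
  -- every pair through `i` vanishes as well
  have hthrough : ∀ m, m ≠ i → coeff (Finsupp.single i 1 + Finsupp.single m 1) a = 0 := by
    intro m hm
    have h := coeff_single_strict i τ ha hG hm
    rw [hlin m] at h
    have hsum : ∑ s ∈ Finset.univ.erase i, τ s * ((((Finsupp.single s 1 : Fin n →₀ ℕ) m : ℕ) : κ) + 1) *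
        coeff (Finsupp.single s 1 + Finsupp.single m 1) a = 0 := by
      refine Finset.sum_eq_zero fun s hs => ?_
      have hsi : s ≠ i := Finset.ne_of_mem_erase hs
      by_cases hsm : s = m
      · subst hsm
        have : (((Finsupp.single s 1 : Fin n →₀ ℕ) s : ℕ) : κ) + 1 = 0 := by
          simp only [Finsupp.single_eq_same, Nat.cast_one]
          exact CharTwo.add_self_eq_zero 1
        rw [this, mul_zero, zero_mul]
      · rw [H s m hsm hsi hm, mul_zero]
    rw [hsum, add_zero] at h
    exact h.symm
  obtain ⟨j, l, hjl, hne⟩ := hpair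
  apply hne
  by_cases hj : j = i
  · subst hj
    exact hthrough l (Ne.symm hjl)
  · by_cases hl : l = i
    · subst hl
      rw [add_comm]
      exact hthrough j hj
    · exact H j l hjl hj hl

end BlowFam

end MuDropCharTwoOrdP

end Summit.ResolutionOfSingularities.ResolutionOfSingularities.Theorems.WildCones

end
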